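import Summits.HodgeConjecture.HodgeConjecture.Theorems.VHCAbelianSchemesRoadTwistConfinedMoverFamilyDefs
import HarnessLib

/-!
# Road №4 (`VHCAbelianSchemesRoad`), crux stmt-HodgeConjecture-26512 — lens line «transfer», kernel node (inj):
# `pr_Ĵ` IS INJECTIVE ON EVERY MOVER KERNEL `Ker u_m ⊆ (J × Ĵ)(ℂ)`

research route conditional on HC_CM; not a corollary; Q11.4-sentence-2 already refuted in dim ≥ 3.
NOTHING here says (MM), (c4a-T), (c4a) `PrintSheafHandleExists`, the crux, №4, HC_AV, HC_CM or HC holds; HC_CM HELD, by name only.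

This file PROVES the statement of the Cruxes workfile's stub `stub_injOnMoverKernels_sndDual`
(`Cruxes/DiagLocalOfMarkmanPinnedForall/TwistConfinedMoverFamily.lean` e60e5d7771542aa1, §2) VERBATIM, against the Theorems-lane
vocabulary `Theorems/VHCAbelianSchemesRoadTwistConfinedMoverFamilyDefs.lean` (director-hodge g16 R16.47 (2)(b), seat core-w3 g2;
idea-crit-6 g4 ruling 26512-T1: «(inj) is S and may go first»):

* `injOnMoverKernels_sndDual D : InjOnMoverKernels D (fun _ => sndDual D)` — for EVERY `m` (the coprimality premise of
  `InjOnMoverKernels` is not used): if `y ∈ (J × Ĵ)(ℂ)` has `u_m(y) = 1` and `pr_Ĵ(y) = 1` then `y = 1`. Proof (refute-markman W9 §1 (a),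
  «`Ker u_m(ℂ) = {(−mc, φ_Θ c)}`»): `u_m = m + φ_d` and `φ_d ≫ pr_Ĵ = pr_J ≫ φ_Θ` (`weilOperator_snd`), so on points
  `pr_Ĵ(u_m y) = pr_Ĵ(y)^m · φ_Θ(pr_J y)`; with `u_m y = 1`, `pr_Ĵ y = 1` this gives `φ_Θ(pr_J y) = 1`, i.e. `pr_J y ∈ Ker φ_Θ(ℂ) = K(Θ) = 0`
  (`kerPoints_phiTheta_eq`, `K(Θ) = ⊥` for the principal `Θ` of the datum), so both projections of `y` are trivial and `y = 1`;
* `sndDualInjOnMoverKernels_holds : SndDualInjOnMoverKernels` — the statement-Prop of the vocabulary file, discharged.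

References: [cite: Markman2025SecantWeil, §9.3 Lemma 9.3.3 (the kernel of u = m + φ_d on X × X̂)] [cite: MumfordAV1970, §23 (K(L) and φ_L)]
-/

noncomputable section

open CategoryTheory CategoryTheory.Limits AlgebraicGeometry Topology

namespace Summit.HodgeConjecture.HodgeConjecture.Ring2.SemiregularRepresentatives

set_option linter.dupNamespace false -- the cell's namespace repeats the summit name, as in every `Ring2*` file

namespace TwistConfinedMoverFamily

open Literature.AlgebraicGeometry Literature.AlgebraicGeometry.Motives Literature.AlgebraicGeometry.Motives.AbelianVariety
open Literature.AlgebraicGeometry.HodgeTheory Literature.AlgebraicGeometry.Markman2025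
open Literature.AlgebraicTopology.SingularHomology
open scoped MonObj

/-- `1 ≫ f = 1` on `T`-valued points for a homomorphism `f` of abelian varieties (the trivial point lies in every kernel;
the tree's `Hom.one_mem_kerPoints`, unfolded). [cite: MumfordAV1970, §4 (homomorphisms preserve the identity)] -/
theorem one_comp_hom_eq_one {A B : AbelianVariety ℂ} (f : A ⟶ B) (T : SchemeOver ℂ) :
    (1 : T ⟶ A.X) ≫ f.hom.hom.hom = 1 :=
  (Hom.mem_kerPoints_iff f (1 : T ⟶ A.X)).1 (Hom.one_mem_kerPoints f)

/-- **A point of `J × Ĵ` both of whose projections are trivial is trivial** (points of a fibre product are pairs of points,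
Hartshorne II Thm. 3.3; the projections are homomorphisms). [cite: MumfordAV1970, §4 (products of abelian varieties)] -/
theorem point_prod_eq_one_of_fst_of_snd (D : SecantQuotientDatum) {T : SchemeOver ℂ}
    (y : T ⟶ D.P.X) (h₁ : y ≫ (fst D.𝒥.J (D.𝒥.J.dualOf D.Θ D.isAmple) : D.P ⟶ D.𝒥.J).hom.hom.hom = 1)
    (h₂ : y ≫ (snd D.𝒥.J (D.𝒥.J.dualOf D.Θ D.isAmple) : D.P ⟶ D.𝒥.J.dualOf D.Θ D.isAmple).hom.hom.hom = 1) : y = 1 := by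
  have e₁ := one_comp_hom_eq_one (fst D.𝒥.J (D.𝒥.J.dualOf D.Θ D.isAmple) : D.P ⟶ D.𝒥.J) T
  have e₂ := one_comp_hom_eq_one (snd D.𝒥.J (D.𝒥.J.dualOf D.Θ D.isAmple) : D.P ⟶ D.𝒥.J.dualOf D.Θ D.isAmple) T
  exact CartesianMonoidalCategory.hom_ext y 1 (h₁.trans e₁.symm) (h₂.trans e₂.symm)

/-- **(inj) — `pr_Ĵ` is injective on every mover kernel**: the statement of the workfile's `stub_injOnMoverKernels_sndDual` VERBATIM
(for EVERY `m`; the coprimality premise is not needed). `u_m = m + φ_d`, `φ_d ≫ pr_Ĵ = pr_J ≫ φ_Θ`, so `pr_Ĵ(u_m y) = pr_Ĵ(y)^m · φ_Θ(pr_J y)`;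
hence `u_m y = 1 = pr_Ĵ y` forces `φ_Θ(pr_J y) = 1`, `pr_J y ∈ K(Θ) = 0`, and `y = 1`.
[cite: Markman2025SecantWeil, §9.3 Lemma 9.3.3 (the kernel of u = m + φ_d on X × X̂)] [cite: MumfordAV1970, §23 (K(L) and φ_L)] -/
theorem injOnMoverKernels_sndDual (D : SecantQuotientDatum) : InjOnMoverKernels D (fun _ => sndDual D) := by
  intro m _ y hu hsnd
  rw [AlgPoints.map_apply] at hu hsnd
  -- `pr_Ĵ y = 1`
  have hsnd' : y ≫ (snd D.𝒥.J (D.𝒥.J.dualOf D.Θ D.isAmple)).hom.hom.hom = 1 := hsnd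
  -- `u_m ≫ pr_Ĵ = m • pr_Ĵ + pr_J ≫ φ_Θ`
  have hdesc : D.weilEndo m ≫ snd D.𝒥.J (D.𝒥.J.dualOf D.Θ D.isAmple) =
      snd D.𝒥.J (D.𝒥.J.dualOf D.Θ D.isAmple) ≫ (m • 𝟙 (D.𝒥.J.dualOf D.Θ D.isAmple)) +
        fst D.𝒥.J (D.𝒥.J.dualOf D.Θ D.isAmple) ≫ D.𝒥.J.phiTheta D.Θ D.isAmple := by
    rw [SecantQuotientDatum.weilEndo_def, Preadditive.add_comp, Preadditive.zsmul_comp, Category.id_comp,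
      Preadditive.comp_zsmul, Category.comp_id]
    exact congrArg _ (weilOperator_snd D.isAmple D.KTheta_eq_bot D.d)
  -- on points: `pr_Ĵ(u_m y) = 1`
  have h1 : y ≫ (D.weilEndo m ≫ snd D.𝒥.J (D.𝒥.J.dualOf D.Θ D.isAmple)).hom.hom.hom = 1 := by
    change (y ≫ (D.weilEndo m).hom.hom.hom) ≫ (snd D.𝒥.J (D.𝒥.J.dualOf D.Θ D.isAmple) : D.P ⟶ _).hom.hom.hom = 1
    rw [hu]
    exact one_comp_hom_eq_one (snd D.𝒥.J (D.𝒥.J.dualOf D.Θ D.isAmple) : D.P ⟶ _) _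
  -- … `= pr_Ĵ(y)^m · φ_Θ(pr_J y) = φ_Θ(pr_J y)`
  have h2 : y ≫ (snd D.𝒥.J (D.𝒥.J.dualOf D.Θ D.isAmple) ≫ (m • 𝟙 (D.𝒥.J.dualOf D.Θ D.isAmple))).hom.hom.hom = 1 := by
    change (y ≫ (snd D.𝒥.J (D.𝒥.J.dualOf D.Θ D.isAmple) : D.P ⟶ _).hom.hom.hom) ≫
      (m • 𝟙 (D.𝒥.J.dualOf D.Θ D.isAmple)).hom.hom.hom = 1
    rw [hsnd']
    exact one_comp_hom_eq_one (m • 𝟙 (D.𝒥.J.dualOf D.Θ D.isAmple)) _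
  rw [hdesc] at h1
  have h3 : y ≫ (snd D.𝒥.J (D.𝒥.J.dualOf D.Θ D.isAmple) ≫ (m • 𝟙 (D.𝒥.J.dualOf D.Θ D.isAmple)) +
        fst D.𝒥.J (D.𝒥.J.dualOf D.Θ D.isAmple) ≫ D.𝒥.J.phiTheta D.Θ D.isAmple).hom.hom.hom =
      (y ≫ (snd D.𝒥.J (D.𝒥.J.dualOf D.Θ D.isAmple) ≫ (m • 𝟙 (D.𝒥.J.dualOf D.Θ D.isAmple))).hom.hom.hom) *
        (y ≫ (fst D.𝒥.J (D.𝒥.J.dualOf D.Θ D.isAmple) ≫ D.𝒥.J.phiTheta D.Θ D.isAmple).hom.hom.hom) :=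
    MonObj.comp_mul _ _ _
  rw [h3, h2, one_mul] at h1
  -- so `pr_J y ∈ Ker φ_Θ (ℂ) = K(Θ) = ⊥`
  have hfst : y ≫ (fst D.𝒥.J (D.𝒥.J.dualOf D.Θ D.isAmple)).hom.hom.hom = 1 := by
    have hker : y ≫ (fst D.𝒥.J (D.𝒥.J.dualOf D.Θ D.isAmple)).hom.hom.hom ∈
        Hom.kerPoints (specOver ℂ ℂ) (D.𝒥.J.phiTheta D.Θ D.isAmple) := by
      rw [Hom.mem_kerPoints_iff]
      exact h1
    rw [kerPoints_phiTheta_eq, D.KTheta_eq_bot] at hker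
    exact (Subgroup.mem_bot).1 hker
  exact point_prod_eq_one_of_fst_of_snd D y hfst hsnd'

/-- **(inj) as the vocabulary's statement-Prop, DISCHARGED**: `SndDualInjOnMoverKernels` holds.
[cite: Markman2025SecantWeil, §9.3 Lemma 9.3.3 (the kernel of u = m + φ_d on X × X̂)] -/
theorem sndDualInjOnMoverKernels_holds : SndDualInjOnMoverKernels := fun D => injOnMoverKernels_sndDual D

end TwistConfinedMoverFamily

end Summit.HodgeConjecture.HodgeConjecture.Ring2.SemiregularRepresentatives

end
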